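import Summits.BirchSwinnertonDyer.BirchSwinnertonDyer.Theorems.ClassRecordThreeCornerAtThreeShimuraWalkFamilyDictionary
import HarnessLib

/-!
# END GLUE of the (DIV) port, level-supply half: the port target's per-family predicate `ShimuraWalk.LevelSupplyAt hK ι W N p ys t`
# (Gross conductors, `mdiv`, Gross depth) ⟸ the per-level inequality of the FAMILY-DATUM walk (tam3-p1's (P2) road: data
# `d : JET.KolyvaginFamilyData W K ι n` WITH `d.y = ys n`, Zhang conductors, `divOrd`, Zhang index) — and the same for the swap half in
# Gross currency (cell `bsd-stepL`, seat `bsd-stepL-corner3-p2` g8 = WIDTH-LEVER lane B; `--supports stmt-BirchSwinnertonDyer-21420 --as helper`)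

WHY (plan g39 RULING 47 (4); HOME/corner3/g8/CORNER3-G8.md §2). After the dictionary `…ShimuraWalkFamilyDictionary` (p598128:
`ShimuraWalk.PDiv ↔ KolyvaginFamilyData.PDiv`, `min M mdiv = min M divOrd`, Gross conductors are Zhang-admissible) the two port targets
of BOTH corner lines (`ShimuraWalk.{Swap,Level}SupplyAtThreeB6`, which unfold to `SwapSupplyAt` ∕ `LevelSupplyAt` per labelled family) follow
from datum-currency statements by ORDER BOOKKEEPING ONLY. THIS FILE fixes those datum-currency statements — the shapes the (P1)∕(P2) seats
are to prove for the labelled CM family — and proves the glue: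
* `levelSupplyAt_of_familyLevelSupply` : `LevelSupplyAt hK ι W N_E p ys t` ⟸ `hlevF` = tam3-p1's `hlev` binder of
  `KolyvaginFamilyData.pDiv_of_swap_of_perLevel` (p592810) RESTRICTED to the data of the family (`d.y = ys n`; the unrestricted «∀ d» of the
  combinator is not provable on a Shimura frame — a datum may carry any point `y`), plus the weak (B4) label of `ys` (for the dictionary).
  Bookkeeping: `m(c) < k` forces `m′(c) = μ₀ < k ≤ M_Gross(c)`; at depth `k + μ₀ ≤ M_Gross(c) ≤ M_Zhang(c)` the dictionary gives `ord_p(P_c) = μ₀`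
  for the datum `d` populated from `ys` (`exists_familyData_y_eq`), so `hlevF` at `(k, c, d)` is the claim.
* `swapSupplyAt_of_familySwapSupply` : `SwapSupplyAt hK ι W N_E p ys` ⟸ `hswapF` = the prime swap for the data of the family in GROSS
  currency (admissibility `IsKolyvaginPrime ∧ FrobEqFrobInfty (p^{μ+1})`, output conductor of Gross depth `≥ e` — the native output of the
  Čebotarev step; W. Zhang's numeric index is implied, `zhangAdmissible_of_conductor`, not conversely), plus weak (B4).
HONEST FRAMING: theorems only (no definition, no named fact, no `sorry`); CONDITIONAL on the displayed datum-currency supplies, which are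
OPEN for the CM family of `X_{N⁺,N⁻}` ((P1) corner-p1 g15, (P2) tam3-p1 g13); nothing about any curve; no stub closes; BSD is not proved by
any of this; T7. References: [cite: Jetchev2008, Thm. 1.4 (p. 812), §6] [cite: McCallumLMS1991, §5 Prop. 5.2] [cite: WZhang2014, Notations (xii)]
[cite: GrossLMS1991, §3 (3.2)–(3.3)]. presearch: not applicable (glue between tree currencies); `lean search 'of_familyLevelSupply|of_familySwapSupply'` → none.
-/

set_option autoImplicit false
set_option linter.dupNamespace false

noncomputable section

open scoped Classical

namespace Summit.BirchSwinnertonDyer.BirchSwinnertonDyer.Theorems.ShimuraWalk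

open WeierstrassCurve Field NumberField IsDedekindDomain Finset
  Literature.NumberTheory.EllipticCurves Literature.NumberTheory.GaloisRepresentations
  Literature.NumberTheory.EllipticCurves.KolyvaginCocycle
  Literature.NumberTheory.EllipticCurves.KolyvaginEuler
  Literature.NumberTheory.EllipticCurves.RingClassField
  Literature.NumberTheory.EllipticCurves.ModularForms
  Summit.BirchSwinnertonDyer.Rank1Residual.X11b
  Summit.BirchSwinnertonDyer.Rank1Residual.JET
  Summit.BirchSwinnertonDyer.BirchSwinnertonDyer.Theorems

variable {K : Type} [Field K] [NumberField K] {W : WeierstrassCurve ℚ}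

/-- In `ℕ∞`: if `min a b = c` and `c < a` then `b = c`. [folklore] -/
theorem eq_of_min_eq_of_lt {a b c : ℕ∞} (h : min a b = c) (hc : c < a) : b = c := by
  rcases min_eq_iff.mp h with ⟨ha, -⟩ | ⟨hb, -⟩
  · exact absurd ha (ne_of_gt hc)
  · exact hb

/-- **`ShimuraWalk.PDiv ⟹ d.PDiv` with NO depth hypothesis** (the (→) half of `pDiv_iff_familyData_pDiv`: instantiate the universal
divisibility at the datum's transversal presentation pulled into `𝒢_k`; x11b3-p8's H37 bridge identifies its Kolyvagin point with
`d.derivedPoint`). Needs only: `k` square-free with inert prime factors, `d.y = ys k`. [cite: GrossLMS1991, §4 (4.1)] -/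
theorem familyData_pDiv_of_pDiv (hK : IsImaginaryQuadratic K) (ι : K →+* ℂ) {p k : ℕ} (hk : Squarefree k)
    (hinert : ∀ q ∈ k.primeFactors, (Ideal.span {(q : 𝓞 K)}).IsPrime)
    (ys : (m : ℕ) → (W.baseChange (ringClassField K ι m)).toAffine.Point)
    (d : KolyvaginFamilyData W K ι k) (hy : d.y = ys k) {μ : ℕ} (hPD : PDiv hK ι W ys p k μ) : d.PDiv p μ := by
  letI hcg : CommGroup (ringClassGal ι k) := { (inferInstance : Group (ringClassGal ι k)) with
    mul_comm := fun a b ↦ (KolyvaginH44.isMulCommutative_ringClassGal' hK ι k).is_comm.comm a b }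
  letI act : DistribMulAction (ringClassGal ι k) ((W.baseChange (ringClassField K ι k)).toAffine.Point) :=
    DistribMulAction.compHom _ ((pointGalHom W (ringClassField K ι k)).comp (ringClassGal ι k).subtype)
  haveI : Finite (ringClassGal ι k) := KolyvaginH44.finite_ringClassGal hK ι k
  set ρ : ringClassGal ι k →* (ringClassField K ι k ≃ₐ[ℚ] ringClassField K ι k) := (ringClassGal ι k).subtype
    with hρ
  have hρi : Function.Injective ρ := (ringClassGal ι k).subtype_injective
  have hsmul : ∀ (g : ringClassGal ι k) (Q : (W.baseChange (ringClassField K ι k)).toAffine.Point),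
      g • Q = pointGalHom W (ringClassField K ι k) (ρ g) Q := fun _ _ ↦ rfl
  have hσmem : ∀ q ∈ k.primeFactors, d.σ q ∈ ringClassGal ι k := fun q hq ↦
    ringClassGalOver_le_ringClassGal ι k (k / q) ((d.zpowers_σ q hq) ▸ Subgroup.mem_zpowers (d.σ q))
  let σ₁ : ℕ → ringClassGal ι k := fun q ↦ if hq : q ∈ k.primeFactors then ⟨d.σ q, hσmem q hq⟩ else 1
  have hσ₁ : ∀ q ∈ k.primeFactors, ρ (σ₁ q) = d.σ q := fun q hq ↦ by
    simp only [σ₁, dif_pos hq]; rfl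
  have hord₁ : ∀ q ∈ k.primeFactors, σ₁ q ^ (q + 1) = 1 := fun q hq ↦ hρi (by
    rw [map_pow, hσ₁ q hq, map_one]; exact familyData_σ_pow_succ_eq_one hK d hk hq (hinert q hq))
  have hz₁ : ∀ q ∈ k.primeFactors, (Subgroup.zpowers (σ₁ q)).map ρ = ringClassGalOver ι k (k / q) := fun q hq ↦ by
    rw [MonoidHom.map_zpowers, hσ₁ q hq]; exact d.zpowers_σ q hq
  set Hc : Subgroup (ringClassGal ι k) := (ringClassGalOver ι k 1).comap ρ with hHc
  letI : Fintype (ringClassGal ι k ⧸ Hc) := Fintype.ofFinite _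
  have hHc' : ∀ h ∈ Hc, ρ h ∈ ringClassGalOver ι k 1 := fun h hh ↦ Subgroup.mem_comap.mp hh
  have hSρ : ((d.S : Set (ringClassField K ι k ≃ₐ[ℚ] ringClassField K ι k))) ⊆ Set.range ρ :=
    fun s hs ↦ ⟨⟨s, d.S_subset s hs⟩, rfl⟩
  obtain ⟨g, hg, hgS⟩ := exists_section_comap_of_transversal ι k ρ (fun g ↦ g.2) hSρ d.S_transversal
  have hbij := KolyvaginH37Bridge.bijOn_of_section_of_transversal ρ hρi (H := Hc)
    (Γ := ringClassGal ι k) (G₁ := ringClassGalOver ι k 1) hHc'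
    (S := (↑d.S : Set (ringClassField K ι k ≃ₐ[ℚ] ringClassField K ι k)))
    (fun s hs ↦ d.S_subset s hs) hSρ (fun g hg ↦ d.S_transversal g hg) g hg hgS
  have hbr : kolyvaginPoint σ₁ k.primeFactors g (ys k) = d.derivedPoint := by
    have h := KolyvaginH37Bridge.map_kolyvaginPoint_eq_derivedPoint (pointGalHom W (ringClassField K ι k))
      ρ (AddMonoidHom.id ((W.baseChange (ringClassField K ι k)).toAffine.Point)) (fun g a ↦ hsmul g a) hk
      (τ := d.σ) hσ₁ g hbij (ys k)
    rw [AddMonoidHom.id_apply, AddMonoidHom.id_apply] at h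
    rw [h, ← hy]
    rfl
  obtain ⟨B, hB⟩ := hPD σ₁ Hc g hord₁ (fun q hq ↦ by rw [← hz₁ q hq, MonoidHom.map_zpowers]; rfl) hg hHc'
  exact ⟨B, hB.trans hbr⟩

/-- **Level-supply glue**: `LevelSupplyAt hK ι W N_E p ys t` from the family-datum per-level inequality `hlevF` (tam3-p1's `hlev` shape,
restricted to data with `d.y = ys n`, Zhang currency) and the weak (B4) label of `ys`. See the module docstring for the bookkeeping.
[cite: Jetchev2008, Thm. 1.4 (p. 812)] [cite: WZhang2014, Notations (xii)] [cite: GrossLMS1991, §3 (3.2)–(3.3)] -/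
theorem levelSupplyAt_of_familyLevelSupply (hK : IsImaginaryQuadratic K) (ι : K →+* ℂ)
    [W.IsElliptic] [W.IsGloballyMinimal] [NeZero (W.conductorNorm ℤ)]
    (Dt : ModularParametrizationData W (W.conductorNorm ℤ)) {p : ℕ} (hp : p.Prime)
    (ys : (m : ℕ) → (W.baseChange (ringClassField K ι m)).toAffine.Point) (t : ℕ)
    (hB4 : ∀ k : ℕ, Squarefree k → (∀ q ∈ k.primeFactors, IsKolyvaginPrime (W.conductorNorm ℤ) W K p q) →
      ∀ ℓ ∈ k.primeFactors, ∀ σ : ringClassField K ι k ≃ₐ[ℚ] ringClassField K ι k,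
      Subgroup.zpowers σ = ringClassGalOver ι k (k / ℓ) →
      ∃ y' : (W.baseChange (ringClassField K ι k)).toAffine.Point,
        ∑ i ∈ Finset.range (ℓ + 1), pointGalHom W (ringClassField K ι k) (σ ^ i) (ys k) =
          W.frobeniusTrace ℓ • y')
    (hlevF : ∀ (k n : ℕ) (d : KolyvaginFamilyData W K ι n), d.y = ys n → Squarefree n →
      (∀ ℓ ∈ n.primeFactors, Zhang2014.IsKolyvaginPrime (W.conductorNorm ℤ) W K p ℓ) →
      (if d.divOrd p < Zhang2014.levelIndex W p n then d.divOrd p else (⊤ : ℕ∞)) < (k : ℕ∞) → t ≤ k →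
      (k : ℕ∞) + (if d.divOrd p < Zhang2014.levelIndex W p n then d.divOrd p else ⊤) ≤
        Zhang2014.levelIndex W p n →
      (t : ℕ∞) ≤ (if d.divOrd p < Zhang2014.levelIndex W p n then d.divOrd p else ⊤)) :
    LevelSupplyAt hK ι W (W.conductorNorm ℤ) p ys t := by
  intro k c h0 htk hMc
  -- `m(c) < k` forces `m′(c) < M_Gross(c)` and `m′(c) = μ₀ < k`
  have hlt : mdiv hK ι W ys p c.1 < frobLevelIndex W K p c.1 := by
    by_contra h
    rw [if_neg h] at h0
    exact absurd h0 (not_lt_of_ge le_top)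
  rw [if_pos hlt] at h0 hMc ⊢
  have hne : mdiv hK ι W ys p c.1 ≠ ⊤ := ne_top_of_lt hlt
  set μ₀ : ℕ := (mdiv hK ι W ys p c.1).toNat with hμ₀def
  have hμ₀ : mdiv hK ι W ys p c.1 = (μ₀ : ℕ∞) := (ENat.coe_toNat hne).symm
  rw [hμ₀] at h0 hMc hlt ⊢
  have hμ₀k : μ₀ < k := by exact_mod_cast h0
  have hk1 : 1 ≤ k := by omega
  -- the depth `M := k + μ₀ ≤ M_Gross(c)`
  have hM : ((k + μ₀ : ℕ) : ℕ∞) ≤ frobLevelIndex W K p c.1 := by push_cast; exact hMc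
  have hkol : ∀ q ∈ c.1.primeFactors, IsKolyvaginPrime (W.conductorNorm ℤ) W K p q ∧
      FrobEqFrobInfty W K (p ^ (k + μ₀)) q :=
    fun q hq ↦ ⟨c.2.2 q hq, (natCast_le_frobLevelIndex_iff c.2.2 (k + μ₀)).mp hM q hq⟩
  -- the datum populated from `ys`, and the dictionary at depth `k + μ₀`
  obtain ⟨d, hd⟩ := exists_familyData_y_eq (W := W) hK ι c.2.1 (fun q hq ↦ (c.2.2 q hq).2.2.2.2.1) ys
  have hdict := min_mdiv_eq_min_divOrd hK ι Dt hp (by omega : 1 ≤ k + μ₀) c.2.1 hkol ys d hd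
    (hB4 c.1 c.2.1 (fun q hq ↦ c.2.2 q hq))
  have hμ₀M : (μ₀ : ℕ∞) < ((k + μ₀ : ℕ) : ℕ∞) := by exact_mod_cast (by omega : μ₀ < k + μ₀)
  rw [hμ₀, min_eq_right hμ₀M.le] at hdict
  have hdiv : d.divOrd p = (μ₀ : ℕ∞) := eq_of_min_eq_of_lt hdict.symm hμ₀M
  -- Zhang side
  have hZle : frobLevelIndex W K p c.1 ≤ Zhang2014.levelIndex W p c.1 := frobLevelIndex_le_levelIndex hp c
  have hZK : ∀ ℓ ∈ c.1.primeFactors, Zhang2014.IsKolyvaginPrime (W.conductorNorm ℤ) W K p ℓ := fun ℓ hℓ ↦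
    ((zhangAdmissible_of_conductor hp hk1 c (le_trans (by exact_mod_cast Nat.le_add_right k μ₀) hM)).2 ℓ hℓ).1
  have hltZ : d.divOrd p < Zhang2014.levelIndex W p c.1 := by rw [hdiv]; exact lt_of_lt_of_le hlt hZle
  have key := hlevF k c.1 d hd c.2.1 hZK (by rw [if_pos hltZ, hdiv]; exact_mod_cast hμ₀k) htk
    (by rw [if_pos hltZ, hdiv]; exact hMc.trans hZle)
  rwa [if_pos hltZ, hdiv] at key

/-- **Swap-supply glue**: `SwapSupplyAt hK ι W N_E p ys` from the family-datum prime swap `hswapF` in GROSS currency (admissibility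
`IsKolyvaginPrime ∧ FrobEqFrobInfty (p^{μ+1})` on inputs, Gross depth `≥ e` on the output conductor; divisibility `KolyvaginFamilyData.PDiv`
for data with `d.y = ys n`) and the weak (B4) label of `ys`. [cite: McCallumLMS1991, §5 Prop. 5.2] [cite: GrossLMS1991, §3 (3.2)–(3.3)] -/
theorem swapSupplyAt_of_familySwapSupply (hK : IsImaginaryQuadratic K) (ι : K →+* ℂ)
    [W.IsElliptic] [W.IsGloballyMinimal] [NeZero (W.conductorNorm ℤ)]
    (Dt : ModularParametrizationData W (W.conductorNorm ℤ)) {p : ℕ} (hp : p.Prime)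
    (ys : (m : ℕ) → (W.baseChange (ringClassField K ι m)).toAffine.Point)
    (hB4 : ∀ k : ℕ, Squarefree k → (∀ q ∈ k.primeFactors, IsKolyvaginPrime (W.conductorNorm ℤ) W K p q) →
      ∀ ℓ ∈ k.primeFactors, ∀ σ : ringClassField K ι k ≃ₐ[ℚ] ringClassField K ι k,
      Subgroup.zpowers σ = ringClassGalOver ι k (k / ℓ) →
      ∃ y' : (W.baseChange (ringClassField K ι k)).toAffine.Point,
        ∑ i ∈ Finset.range (ℓ + 1), pointGalHom W (ringClassField K ι k) (σ ^ i) (ys k) =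
          W.frobeniusTrace ℓ • y')
    (hswapF : ∀ (μ e n : ℕ) (d : KolyvaginFamilyData W K ι n), d.y = ys n → Squarefree n →
      (∀ ℓ ∈ n.primeFactors, IsKolyvaginPrime (W.conductorNorm ℤ) W K p ℓ ∧ FrobEqFrobInfty W K (p ^ (μ + 1)) ℓ) →
      (∀ (n' : ℕ) (d' : KolyvaginFamilyData W K ι n'), d'.y = ys n' → Squarefree n' →
        (∀ ℓ ∈ n'.primeFactors, IsKolyvaginPrime (W.conductorNorm ℤ) W K p ℓ ∧ FrobEqFrobInfty W K (p ^ (μ + 1)) ℓ) →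
        d'.PDiv p μ) →
      ¬ d.PDiv p (μ + 1) →
      ∃ (n' : ℕ) (d' : KolyvaginFamilyData W K ι n'), d'.y = ys n' ∧ Squarefree n' ∧
        (∀ ℓ ∈ n'.primeFactors, IsKolyvaginPrime (W.conductorNorm ℤ) W K p ℓ ∧ FrobEqFrobInfty W K (p ^ e) ℓ) ∧
        ¬ d'.PDiv p (μ + 1)) :
    SwapSupplyAt hK ι W (W.conductorNorm ℤ) p ys := by
  intro μ e c hc hall hnot
  have hμ1 : 1 ≤ μ + 1 := Nat.le_add_left 1 μ
  -- Gross admissibility at depth `μ + 1` of the conductor `c`, and of every `c'` in `hall`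
  have hkol : ∀ q ∈ c.1.primeFactors, IsKolyvaginPrime (W.conductorNorm ℤ) W K p q ∧
      FrobEqFrobInfty W K (p ^ (μ + 1)) q :=
    fun q hq ↦ ⟨c.2.2 q hq, (natCast_le_frobLevelIndex_iff c.2.2 (μ + 1)).mp hc q hq⟩
  obtain ⟨d, hd⟩ := exists_familyData_y_eq (W := W) hK ι c.2.1 (fun q hq ↦ (c.2.2 q hq).2.2.2.2.1) ys
  -- `¬ (μ+1) ≤ m′(c)` ⟹ `¬ d.PDiv p (μ+1)` (dictionary, direction datum ⟹ universal)
  have hnotd : ¬ d.PDiv p (μ + 1) := fun h ↦ hnot ((natCast_le_mdiv_iff hK ι W ys p c.1 (μ + 1)).mpr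
    ((pDiv_iff_familyData_pDiv hK ι Dt hp hμ1 c.2.1 hkol ys d hd (hB4 c.1 c.2.1 (fun q hq ↦ c.2.2 q hq)) le_rfl).mpr h))
  -- the inner hypothesis for the data of the family at Gross depth `μ + 1`
  have hall' : ∀ (n' : ℕ) (d' : KolyvaginFamilyData W K ι n'), d'.y = ys n' → Squarefree n' →
      (∀ ℓ ∈ n'.primeFactors, IsKolyvaginPrime (W.conductorNorm ℤ) W K p ℓ ∧ FrobEqFrobInfty W K (p ^ (μ + 1)) ℓ) →
      d'.PDiv p μ := by
    intro n' d' hd' hn' hkol'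
    let c' : Conductor W K (W.conductorNorm ℤ) p := ⟨n', hn', fun q hq ↦ (hkol' q hq).1⟩
    have hc' : ((μ + 1 : ℕ) : ℕ∞) ≤ frobLevelIndex W K p c'.1 :=
      (natCast_le_frobLevelIndex_iff c'.2.2 (μ + 1)).mpr fun q hq ↦ (hkol' q hq).2
    have h := hall c' hc'
    exact (pDiv_iff_familyData_pDiv hK ι Dt hp hμ1 hn' hkol' ys d' hd' (hB4 n' hn' (fun q hq ↦ (hkol' q hq).1))
      (Nat.le_succ μ)).mp ((natCast_le_mdiv_iff hK ι W ys p n' μ).mp h)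
  obtain ⟨n', d', hd', hn', hkol', hnot'⟩ := hswapF μ e c.1 d hd c.2.1 hkol hall' hnotd
  -- the output conductor, of Gross depth `≥ e`; its non-divisibility read back in the universal currency
  let c' : Conductor W K (W.conductorNorm ℤ) p := ⟨n', hn', fun q hq ↦ (hkol' q hq).1⟩
  refine ⟨c', (natCast_le_frobLevelIndex_iff c'.2.2 e).mpr fun q hq ↦ (hkol' q hq).2, fun h ↦ hnot' ?_⟩
  -- `(μ+1) ≤ m′(n')` ⟹ `PDiv … n' (μ+1)` ⟹ `d'.PDiv p (μ+1)` (depth-free instantiation at the datum's own presentation)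
  exact familyData_pDiv_of_pDiv hK ι hn' (fun q hq ↦ (hkol' q hq).1.2.2.2.2.1) ys d' hd'
    ((natCast_le_mdiv_iff hK ι W ys p n' (μ + 1)).mp h)

end Summit.BirchSwinnertonDyer.BirchSwinnertonDyer.Theorems.ShimuraWalk

end
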